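import Mathlib
import HarnessLib

/-!
# The Haar–Stein (Schwinger–Dyson) identity on a group: the mean of a derivative along left translations vanishes

HONEST FRAMING: exact (Metropolis-corrected) sampling algorithms for lattice gauge theory;
figures of merit are autocorrelation/cost numbers at stated couplings and volumes; no
continuum-physics claim.

Venture `LatticeQCDFlow` (cell pub-lqcd), topic `Exactness`, FANOUT row 9 (eng-latcore; the
engine's reference-free exactness observable `schwinger_dyson.residual*`, acceptance test A11,
`tools/sd_check.py`).  NEW WORK of the cell over Mathlib (`integral_mul_left_eq_self`,
`hasDerivAt_integral_of_dominated_loc_of_deriv_le`); nothing is cited as a fact.  Printed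
counterparts, named only: the lattice Schwinger–Dyson / Migdal–Makeenko equations; Stein's method.

`SteinCircle.lean` / `SteinRealLine.lean` / `SteinProduct.lean` type the ONE-VARIABLE identities
behind the U(1), CP(N−1) link and φ⁴ residual columns.  The 4-d SU(N) residual rests on the
GROUP version — "the SU(N) Haar (left-invariant vector field) Stein identity … NOT typed"
(`SteinProduct.lean`, `TYPED-EXACTNESS-MAP.md`).  It is typed here, for every group with a
left-invariant measure and every one-parameter family of left translations; no Lie structure,
exponential map or matrix calculus is needed for the population statement itself.

## Content (`G` a measurable group, `μ` left-invariant; `γ : ℝ → G` ANY curve; `F, h, S : G → ℝ`)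

* `integral_leftTranslate` — `∫ F(γ t · U) dμ(U) = ∫ F dμ` for every `t` (left invariance), so
  `t ↦ ∫ F(γ t · U) dμ(U)` is constant.
* **`haar_stein`** — if `t ↦ F(γ t · U)` is differentiable on a neighbourhood of `0` for a.e. `U`
  with derivative `F' t U` dominated by an integrable `bound`, then `∫ F' 0 U dμ(U) = 0`
  (differentiate the constant under the integral sign; uniqueness of the derivative).
  `haar_stein_of_bounded` — the compact-group form: finite `μ`, a uniform constant bound.
* **`gibbs_stein`** — the Schwinger–Dyson form under a Gibbs law `e^{−S} μ`: for an observable `h`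
  and an action `S` differentiable along `γ` with bounded derivatives `Dh`, `DS` (and `h`, `S`
  bounded along the curve), `∫ (Dh 0 U − h U · DS 0 U) e^{−S U} dμ(U) = 0` when `γ 0 = 1`, i.e.
  `⟨X h⟩ = ⟨h · X S⟩` for the left-invariant derivative `X = d/dt|₀ (· ∘ (γ t · ))` — the
  population statement of the residual `R = X h − h X S` read on every chain.

Dictionary: `G = SU(N)^{links}` (or one link with the rest frozen, `FibreLift.lean`), `μ` = Haar
(right-invariant too, `CompactHaar.lean`), `γ t = exp(t T^a)` on one link, `S = β Σ_P (1 − Re tr U_P /N)`,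
`h` = the engine's test functions (`Re tr (T^a U R†)`-type): summing `a` over a basis gives the
staple-sum form `A_l = U_l R_l` of `schwinger_dyson.residual_links`.  Not here: that sum over
generators, the matrix exponential (the curve is abstract), statistical power.
-/

namespace Summit.Ventures.LatticeQCDFlow.Exactness

open MeasureTheory Measure Filter Metric Set
open scoped Topology

variable {G : Type*} [Group G] [MeasurableSpace G] [MeasurableMul G]
  (μ : Measure G) [μ.IsMulLeftInvariant]

/-! ## §1 Left invariance along a curve, and the Haar–Stein identity -/

/-- Left invariance along any curve: `∫ F(γ t · U) dμ(U) = ∫ F dμ`. -/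
theorem integral_leftTranslate (F : G → ℝ) (γ : ℝ → G) (t : ℝ) :
    ∫ U, F (γ t * U) ∂μ = ∫ U, F U ∂μ :=
  integral_mul_left_eq_self F (γ t)

/-- … so the translated mean is a constant function of `t`. -/
theorem integral_leftTranslate_const (F : G → ℝ) (γ : ℝ → G) :
    (fun t => ∫ U, F (γ t * U) ∂μ) = fun _ => ∫ U, F U ∂μ :=
  funext fun t => integral_leftTranslate μ F γ t

variable {μ}

/-- **Haar–Stein identity.**  `μ` left-invariant, `γ : ℝ → G` any curve, `F` integrable; if for a.e.
`U` the map `t ↦ F (γ t · U)` has derivative `F' t U` at every `t` of a neighbourhood `s ∋ 0`, with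
`‖F' t U‖ ≤ bound U` there for an integrable `bound`, then the mean of the derivative at `0`
vanishes: `∫ F' 0 U dμ(U) = 0`. -/
theorem haar_stein {F : G → ℝ} {F' : ℝ → G → ℝ} {γ : ℝ → G} {bound : G → ℝ} {s : Set ℝ}
    (hs : s ∈ 𝓝 (0 : ℝ)) (hF_meas : ∀ t, AEStronglyMeasurable (fun U => F (γ t * U)) μ)
    (hF_int : Integrable F μ) (hF'_meas : AEStronglyMeasurable (F' 0) μ)
    (h_bound : ∀ᵐ U ∂μ, ∀ t ∈ s, ‖F' t U‖ ≤ bound U) (hbound : Integrable bound μ)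
    (h_diff : ∀ᵐ U ∂μ, ∀ t ∈ s, HasDerivAt (fun x => F (γ x * U)) (F' t U) t) :
    ∫ U, F' 0 U ∂μ = 0 := by
  have hint0 : Integrable (fun U => F (γ 0 * U)) μ := hF_int.comp_mul_left (γ 0)
  obtain ⟨-, hderiv⟩ := hasDerivAt_integral_of_dominated_loc_of_deriv_le (μ := μ)
    (F := fun t U => F (γ t * U)) (F' := F') (x₀ := 0) hs (Eventually.of_forall hF_meas) hint0
    hF'_meas h_bound hbound h_diff
  have hconst : HasDerivAt (fun t : ℝ => ∫ U, F (γ t * U) ∂μ) 0 0 := by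
    rw [integral_leftTranslate_const μ F γ]
    exact hasDerivAt_const 0 _
  exact hderiv.unique hconst

/-- **Haar–Stein identity, compact-group form**: finite `μ`, measurable `F` bounded by `C₀`, and a
uniform bound `C` on the derivative along the curve near `t = 0`. -/
theorem haar_stein_of_bounded [IsFiniteMeasure μ] {F : G → ℝ} {F' : ℝ → G → ℝ} {γ : ℝ → G}
    {ε C C₀ : ℝ} (hε : 0 < ε) (hF_meas : Measurable F) (hF_bdd : ∀ U, |F U| ≤ C₀)
    (hF'_meas : Measurable (F' 0)) (h_bound : ∀ U, ∀ t ∈ ball (0 : ℝ) ε, |F' t U| ≤ C)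
    (h_diff : ∀ U, ∀ t ∈ ball (0 : ℝ) ε, HasDerivAt (fun x => F (γ x * U)) (F' t U) t) :
    ∫ U, F' 0 U ∂μ = 0 := by
  refine haar_stein (ball_mem_nhds 0 hε) (fun t => ?_) ?_ hF'_meas.aestronglyMeasurable
    (Eventually.of_forall fun U t ht => ?_) (integrable_const C) (Eventually.of_forall h_diff)
  · exact (hF_meas.comp (measurable_const_mul (γ t))).aestronglyMeasurable
  · exact Integrable.of_bound hF_meas.aestronglyMeasurable C₀ (Eventually.of_forall fun U => by
      rw [Real.norm_eq_abs]; exact hF_bdd U)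
  · rw [Real.norm_eq_abs]; exact h_bound U t ht

/-! ## §2 The Gibbs / Schwinger–Dyson form: `⟨X h⟩ = ⟨h · X S⟩` under `e^{−S} μ` -/

/-- **Schwinger–Dyson identity under a Gibbs law.**  `μ` left-invariant and finite, `γ 0 = 1`;
observable `h` and action `S` measurable, differentiable along `t ↦ γ t · U` on `(−ε, ε)` for every
`U` with derivatives `Dh t U`, `DS t U`; `h`, `S`, `Dh`, `DS` bounded by `C` along the curve.  Then
`∫ (Dh 0 U − h U · DS 0 U) e^{−S U} dμ(U) = 0` — the mean, under the Gibbs law `∝ e^{−S} μ`, of the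
residual `X h − h X S` vanishes. -/
theorem gibbs_stein [IsFiniteMeasure μ] {h S : G → ℝ} {Dh DS : ℝ → G → ℝ} {γ : ℝ → G} {ε C : ℝ}
    (hε : 0 < ε) (hγ : γ 0 = 1) (hh_meas : Measurable h) (hS_meas : Measurable S)
    (hDh_meas : Measurable (Dh 0)) (hDS_meas : Measurable (DS 0))
    (h_h : ∀ U, ∀ t ∈ ball (0 : ℝ) ε, HasDerivAt (fun x => h (γ x * U)) (Dh t U) t)
    (h_S : ∀ U, ∀ t ∈ ball (0 : ℝ) ε, HasDerivAt (fun x => S (γ x * U)) (DS t U) t)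
    (hb_h : ∀ U, |h U| ≤ C) (hb_S : ∀ U, |S U| ≤ C)
    (hb_Dh : ∀ U, ∀ t ∈ ball (0 : ℝ) ε, |Dh t U| ≤ C) (hb_DS : ∀ U, ∀ t ∈ ball (0 : ℝ) ε, |DS t U| ≤ C) :
    ∫ U, (Dh 0 U - h U * DS 0 U) * Real.exp (-S U) ∂μ = 0 := by
  have hC : 0 ≤ C := le_trans (abs_nonneg _) (hb_h 1)
  -- F = h e^{-S}, F' t U = (Dh t U - h(γ t U) DS t U) e^{-S(γ t U)}
  have key := haar_stein_of_bounded (μ := μ) (γ := γ) (F := fun U => h U * Real.exp (-S U))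
    (F' := fun t U => (Dh t U - h (γ t * U) * DS t U) * Real.exp (-S (γ t * U)))
    (C := (C + C * C) * Real.exp C) (C₀ := C * Real.exp C) hε
    (hh_meas.mul (hS_meas.neg.exp)) ?_ ?_ ?_ ?_
  · simpa [hγ] using key
  · intro U
    rw [abs_mul, Real.abs_exp]
    exact mul_le_mul (hb_h U) (Real.exp_le_exp.mpr (by linarith [neg_abs_le (S U), hb_S U]))
      (Real.exp_nonneg _) hC
  · have hγm : Measurable fun U : G => γ 0 * U := measurable_const_mul (γ 0)
    exact ((hDh_meas.sub ((hh_meas.comp hγm).mul hDS_meas)).mul ((hS_meas.comp hγm).neg.exp))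
  · intro U t ht
    rw [abs_mul, Real.abs_exp]
    refine mul_le_mul ?_ (Real.exp_le_exp.mpr ?_) (Real.exp_nonneg _) (by positivity)
    · calc |Dh t U - h (γ t * U) * DS t U| ≤ |Dh t U| + |h (γ t * U) * DS t U| := abs_sub _ _
        _ ≤ C + C * C := by
          rw [abs_mul]
          exact add_le_add (hb_Dh U t ht) (mul_le_mul (hb_h _) (hb_DS U t ht) (abs_nonneg _) hC)
    · linarith [neg_abs_le (S (γ t * U)), hb_S (γ t * U)]
  · intro U t ht
    have h2 : HasDerivAt (fun x => Real.exp (-S (γ x * U))) (Real.exp (-S (γ t * U)) * -DS t U) t :=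
      ((h_S U t ht).neg).exp
    refine ((h_h U t ht).mul h2).congr_deriv ?_
    ring

end Summit.Ventures.LatticeQCDFlow.Exactness
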